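import Literature.MathematicalPhysics.QuantumFieldTheory.Balaban1983to89.B9Eq3132NuReading
import Literature.MathematicalPhysics.QuantumFieldTheory.Balaban1983to89.B9Thm314WholePinGeometry
import Literature.MathematicalPhysics.QuantumFieldTheory.Balaban1983to89.Node00.OpsYSectEStarGeometry
import HarnessLib

/-!
# `Balaban1983to89.B1Eq324BenfattoClassSectEMemberPRowDictionaryAtNode00` — THE `P`-ROW (R2′a)|_Λ OF THE PRINT-UNIT (3.24) PRECISION DOOR IS
# NODE N06's REPAIRED ROW 26: T. Bałaban, *Propagators for lattice gauge theories in a background field*, Commun. Math. Phys. **99** (1985) 389–434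
# [Balaban1985BackgroundPropagators], (3.132) p. 422, read through seat n06-i's `ν`-weights on the bonds of `Λ` (top level)

statement-level companion of published sources with citation tags; every declaration here is a theorem; nothing here is a claim about the
Yang–Mills mass gap

WHY THIS MODULE (cell `pub-ymgap`, seat `dag-n08-d` gen 31, CLAIM-88 ∕ INTENT-88; node N08 [Balaban1985UV3], the (α)-row `h324` behind [Balaban1985UV3] (3.24)).
The print-unit precision door of record (seat n08-b, `B1Eq324BenfattoClassSectEMemberPrecisionDoorOnLambda.eq324_CsDeltaCY_precision_opsYOfRecordV8E_trBasis_of_plaqSmall_onΛ_on_unit`,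
p676397 §3) displays, among the rows it does not discharge, the `P`-ROW (R2′a) ON Λ-BONDS IN PRINT's UNITS:
* `∀ u v, inΛY x u → inΛY x v → (⨆_{‖E‖ ≤ 1} ‖((λ_x : ℂ) • (QG₁Q*)⁻¹(U))(δ_v ⊗ E)(u)‖) ≤ B_P·e^{−δ|y_u − y_v|}`,
  `λ_x := ((L^k)⁻¹)^{d+1} = η^{d+1}` (def-Y `etaDY x`), `(QG₁Q*)⁻¹(U) = (lettersYOfRecordV4 N θ M⋆ 𝔯 x).QG1Qinv U`, `|y − y′| = unitDistY`.
Node N06's ROW 26 OF RECORD is seat n06-i's REPAIRED (3.132) (`B9Eq3132NuReading`, p508771): print's *«|(QGQ*)⁻¹(y, y′)| ≤ O(1)(Lʲη)^{−2}(L^{j′}η)^{−d}e^{−δ₁d(y,y′)}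
… and the same for the operator with G₁»* for the `ν`-WEIGHTED reading `kerν(U; y, y′) = ν(y)ν(y′)·sup_{‖E‖≤1}‖((QG₁Q*)⁻¹(U)(δ_{y′} ⊗ E))(y)‖` of def-Y's flat letter,
`ν(y) = (Lʲη)^{−(1+D∕2)}·Λ_y` (`nuY`), at the instance `opsYNuOfRecordV4E` (`s3132Nu_opsYNuOfRecordV4E`: `B9.Stmt3132Printed (θ.d₆+1) c35 geo9Y bg9Y (…QGQinv) (…QG1Qinv)`
from four Λ-normalised Combes–Thomas binders — N06's content).  THIS FILE is the TOP-LEVEL DICTIONARY between the two: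
* §1 on a bond of `Λ` (`inΛY_top`: level `k`; `c_f = Lᵏ`, `MemberY.hcfk`): `(geo9K).len u = Lᵏη = 1` (`len_eq_one_of_inΛY`), [4]'s `Λ_u² = wt = ((Lᵏ)⁻¹)^{d+1}`
  (`wt_eq_inv_pow_of_inΛY`), hence ★ `nuY_mul_nuY_of_inΛY`: `ν(u)ν(v) = ((Lᵏ)⁻¹)^{d+1} = λ_x` for `u, v ∈ Λ` (any dimension exponent);
* §2 a non-negative real scalar passes through def-Y's sup-reading (`iSup_norm_real_smul_deltaY`);
* §3 ★★★ `pRowOnΛ_of_ineq3132_nu` — ONE member, ONE background, ANY letter `O`: `B9.Ineq3132 dd (siteKernelOfOpNu … (nuY dd′ …) O) C δ₁ U` gives the door's row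
  with `B_P := C`, `δ := δ₁` (`|y − y′| ≤ d(y, y′)`: `unitDistY_le_dist`);
* §4 ★★ `pRowOnΛ_family_of_stmt3132Printed_nu` — the family form unpacked from `B9.Stmt3132Printed` (thresholds `M₄, a₀`, regularity `Reg335 ∕ Reg336` kept verbatim);
* §5 AT THE `ν`-INSTANCE OF RECORD: ★★★ `pRowOnΛ_opsYNuOfRecordV4E_of_ineq3132` (per `U`) and ★★★ `pRowOnΛ_family_opsYNuOfRecordV4E` (from the conclusion TYPE of
  `s3132Nu_opsYNuOfRecordV4E`), conclusions at `(lettersYOfRecordV4 N θ M⋆ 𝔯 x).QG1Qinv U` with the door's literal token — so (R2′a)|_Λ of p676397 §3 is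
  N06's row 26 of record BY NAME (at `𝔯 := resYOfC2 N θ M⋆ 𝔠`).
* §6 (v1.1, seat `dag-n08-d` gen 38, INTENT-96, on dag-n08-b's first-refusal offer for the (R2′) row of the (3.24) door AT THE STAR LETTERS,
  INTENT-22∕23; ONE new light import `Node00.OpsYSectEStarGeometry` for the name `inΛstY`) TOP-LEVEL ∕ STAR PAIRS: §1–§5 used of `inΛY` only `lvl u = k`
  (`inΛY_top`), so the whole dictionary holds on ANY two top-level bonds — `len_eq_one_of_lvl_eq`, `wt_eq_inv_pow_of_lvl_eq`, `lamY_mul_lamY_of_lvl_eq`,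
  ★ `nuY_mul_nuY_of_lvl_eq`, ★★★ `pRowTop_of_ineq3132_nu` (§3 on `lvl u = k ∧ lvl v = k`), ★★★ `pRowOnΛst_of_ineq3132_nu` (node00-def-Y's star variables
  `inΛstY`, p689888: at least one end block good, [Balaban1984PropagatorsII] (2.3) p. 224), `norm_smul_apply_deltaY_le_of_ineq3132_nu_st`, and at the record
  ★★★ `pRowTop_opsYNuOfRecordV4E_of_ineq3132` ∕ ★★★ `pRowOnΛst_opsYNuOfRecordV4E_of_ineq3132` (per `U`) ∕ ★★ `pRowOnΛst_family_opsYNuOfRecordV4E`.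

HONEST SCOPE.  Count-neutral bookkeeping (one `rpow` at base `1`, one square root, one monotonicity of `exp`); nothing of [Balaban1985BackgroundPropagators] (3.132)
is asserted — N06's four Λ-normalised Combes–Thomas binders (`CoerciveUnder ∕ DecayUnder` ×2) stay N06's content and print's thresholds ∕ regularity conditions
are carried verbatim; the door's (R2′a)|_Λ merely changes from DISPLAYED to «N06's row 26 by name»; the `𝒥`-row at general `U` and `γ₀` stay displayed; the IDENT
is NOT made; `PrintedUV3V` ∕ row `h324c` NOT discharged; node N08 NOT discharged; one finite 𝕋^{d+1} programme — nothing about d = 4 specifically, the continuum,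
OS axioms, a mass gap or the Clay problem.  No `sorry`, no `def`, no `instance`, no `notation`.
(v1.1) §6 changes no content: the same bookkeeping on top-level ∕ star pairs instead of `Λ`-pairs; nothing of (3.132) asserted.
-/

noncomputable section

namespace Literature.MathematicalPhysics.QuantumFieldTheory.Balaban1983to89.B1Eq324BenfattoClassSectEMemberPRowDictionaryAtNode00

open Literature.MathematicalPhysics.QuantumFieldTheory
open Literature.MathematicalPhysics.QuantumFieldTheory.Balaban1983to89.B9PinMembersKLevelV1 (MemberY geo9Y bg9Y)
open Literature.MathematicalPhysics.QuantumFieldTheory.Balaban1983to89.B9PinGeometryKLevelV1 (unitDistY unitDistY_nonneg inΛY inΛY_top)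
open Literature.MathematicalPhysics.QuantumFieldTheory.Balaban1983to89.B6KLevelCensusIndexV1 (KIdx len_eq)
open Literature.MathematicalPhysics.QuantumFieldTheory.Balaban1983to89.B6Ineq2142KLevelV1 (lvl lvl_le)
open Literature.MathematicalPhysics.QuantumFieldTheory.Balaban1983to89.B6Prop27KLevelV1 (wt lam)
open Literature.MathematicalPhysics.QuantumFieldTheory.Balaban1983to89.B9Eq3132NuReading (siteKernelOfOpNu siteKernelOfOpNu_ker lamY nuY nuY_pos
  opsYNuOfRecordV4E opsYNuOfRecordV4E_QG1Qinv)
open Literature.MathematicalPhysics.QuantumFieldTheory.Balaban1983to89.B9Thm314WholePinGeometry (unitDistY_le_dist)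
open Literature.MathematicalPhysics.QuantumFieldTheory.Balaban1983to89.B9Eq3132RingInverseReading (siteKernelOfOp_ker_nonneg)
open Literature.MathematicalPhysics.QuantumFieldTheory.Balaban1983to89.B9GeoNormsKLevelV1 (geo9K geo9K_len_kGeo)
open Literature.MathematicalPhysics.QuantumFieldTheory.Balaban1983to89.Node00

variable {𝔸 : Type} [NormedRing 𝔸] [NormedAlgebra ℂ 𝔸] [CompleteSpace 𝔸]
variable {d ℓ : ℕ} {hd : 1 ≤ d + 1} {hL : Odd (ℓ + 1) ∧ 1 < ℓ + 1} {b₀ b₁ : ℝ} {Mstar : ℕ}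

/-! ## §1  Top-level units: on a bond of `Λ`, `Lʲη = 1`, `Λ_u² = ((Lᵏ)⁻¹)^{d+1}`, `ν(u)ν(v) = ((Lᵏ)⁻¹)^{d+1}` -/

section TopLevel

variable (x : MemberY d ℓ hd hL b₀ b₁ Mstar)

/-- the member's scale factor is positive: `c_f = Lᵏ > 0`. [cite: Balaban1984PropagatorsII, (2.1) p.224 («η = L^{−k}»), bookkeeping] -/
theorem cf_pos : 0 < x.cf := by
  rw [x.hcfk]; positivity

/-- ★ **ON A BOND OF `Λ` THE SCALE LENGTH IS `Lᵏη = 1`**: `(geo9K x.toKIdx).len u = 1` for `inΛY x u` (level `k`, `η = |c_f|⁻¹ = L^{−k}`).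
[cite: Balaban1985BackgroundPropagators, (3.41) p.397 («Lʲη»), Thm 3.15 p.432 («Λ ⊂ Λ_k»); Balaban1984PropagatorsII, (2.1) p.224] -/
theorem len_eq_one_of_inΛY {u : IBondY x.toKIdx} (hu : inΛY x u) : (geo9K x.toKIdx).len u = 1 := by
  rw [geo9K_len_kGeo, len_eq, inΛY_top hu, abs_of_pos (cf_pos x), x.hcfk]
  exact div_self (pow_ne_zero _ (by positivity))

/-- the same for the member's geometry `geo9Y x` (`= geo9K x.toKIdx`). [cite: Balaban1985BackgroundPropagators, (3.41) p.397, bookkeeping] -/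
theorem geo9Y_len_eq_one_of_inΛY {u : IBondY x.toKIdx} (hu : inΛY x u) : (geo9Y x).len u = 1 := len_eq_one_of_inΛY x hu

/-- ★ **[4]'s `Λ_u²` ON A BOND OF `Λ` IS THE UNIT FACTOR**: `wt = (Lᵏ∕c_f)²·(L^{d+1})^{−k} = ((Lᵏ)⁻¹)^{d+1}` (`c_f = Lᵏ`).
[cite: Balaban1984PropagatorsII, (2.142) p.248, (2.81) p.237, (2.1) p.224] -/
theorem wt_eq_inv_pow_of_inΛY {u : IBondY x.toKIdx} (hu : inΛY x u) :
    wt x.hN x.D x.hk x.cf u = ((((ℓ + 1 : ℕ) : ℝ)) ^ x.k)⁻¹ ^ (d + 1) := by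
  unfold wt
  rw [inΛY_top hu, x.hcfk, div_self (pow_ne_zero _ (by positivity)), one_pow, one_mul, ← pow_mul, inv_pow, ← pow_mul, mul_comm]

/-- `Λ_u·Λ_v = ((Lᵏ)⁻¹)^{d+1}` for two bonds of `Λ` (`Λ = √wt`). [cite: Balaban1984PropagatorsII, (2.81) p.237, (2.142) p.248, bookkeeping] -/
theorem lamY_mul_lamY_of_inΛY {u v : IBondY x.toKIdx} (hu : inΛY x u) (hv : inΛY x v) :
    lamY x.toKIdx u * lamY x.toKIdx v = ((((ℓ + 1 : ℕ) : ℝ)) ^ x.k)⁻¹ ^ (d + 1) := by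
  unfold lamY lam
  rw [wt_eq_inv_pow_of_inΛY x hu, wt_eq_inv_pow_of_inΛY x hv]
  exact Real.mul_self_sqrt (pow_nonneg (inv_nonneg.2 (pow_nonneg (by positivity) _)) _)

/-- ★ **THE `ν`-WEIGHTS OF TWO BONDS OF `Λ` MULTIPLY TO PRINT's UNIT FACTOR**: `ν(u)ν(v) = ((Lᵏ)⁻¹)^{d+1} = η^{d+1}` (= def-Y's `etaDY x`), whatever the
dimension exponent `dd` of `ν` (the length factor is `1` on `Λ`).  This is the whole dictionary between n06-i's repaired (3.132) reading and the door's print-unit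
kernel reading on Λ-bonds. [cite: Balaban1985BackgroundPropagators, (3.132) p.422; Balaban1984PropagatorsII, (2.149) p.249, (2.1) p.224] -/
theorem nuY_mul_nuY_of_inΛY (dd : ℕ) {u v : IBondY x.toKIdx} (hu : inΛY x u) (hv : inΛY x v) :
    nuY dd x.toKIdx u * nuY dd x.toKIdx v = ((((ℓ + 1 : ℕ) : ℝ)) ^ x.k)⁻¹ ^ (d + 1) := by
  unfold nuY
  rw [len_eq_one_of_inΛY x hu, len_eq_one_of_inΛY x hv, Real.one_rpow, one_mul, one_mul]
  exact lamY_mul_lamY_of_inΛY x hu hv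

end TopLevel

/-! ## §2  A non-negative real scalar passes through def-Y's sup-reading -/

section Scalar

variable {i : KIdx d ℓ hd hL b₀ b₁}

/-- `⨆_{‖E‖≤1} ‖((c : ℂ)•T)(δ_v ⊗ E)(u)‖ = c·⨆_{‖E‖≤1} ‖T(δ_v ⊗ E)(u)‖` for a real `c ≥ 0` (`Real.mul_iSup_of_nonneg`; no boundedness needed).
[cite: Balaban1985BackgroundPropagators, (3.132) p.422, bookkeeping] -/
theorem iSup_norm_real_smul_deltaY {c : ℝ} (hc : 0 ≤ c) (T : (IBondY i → 𝔸) →ₗ[ℂ] (IBondY i → 𝔸)) (u v : IBondY i) :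
    (⨆ E : BallY 𝔸, ‖(((c : ℝ) : ℂ) • T) (deltaY v (E : 𝔸)) u‖) = c * ⨆ E : BallY 𝔸, ‖T (deltaY v (E : 𝔸)) u‖ := by
  rw [Real.mul_iSup_of_nonneg hc]
  refine iSup_congr fun E => ?_
  rw [LinearMap.smul_apply, Pi.smul_apply, norm_smul, Complex.norm_real, Real.norm_of_nonneg hc]

end Scalar

/-! ## §3  ONE member, ONE background: N06's repaired (3.132) ⟹ the door's print-unit `P`-row on Λ-bonds -/

section One

variable {G : Subgroup 𝔸ˣ} (x : MemberY d ℓ hd hL b₀ b₁ Mstar)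

/-- ★★★ **THE `P`-ROW (R2′a)|_Λ OF THE PRINT-UNIT PRECISION DOOR FROM N06's REPAIRED (3.132)** — for ANY unit-lattice bond letter `O(U)` (at the record:
`(QG₁Q*)⁻¹(U)`), ANY dimension exponents: if the `ν`-weighted reading satisfies (3.132) at `U` with constants `(C, δ₁)`, then on the bonds of `Λ`
`⨆_{‖E‖≤1} ‖((λ_x : ℂ)•O(U))(δ_v ⊗ E)(u)‖ ≤ C·e^{−δ₁|y_u − y_v|}`, `λ_x = ((Lᵏ)⁻¹)^{d+1}` — because `ν(u)ν(v) = λ_x`, `Lʲη = 1` there, and `|y − y′| ≤ d(y, y′)`.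
[cite: Balaban1985BackgroundPropagators, (3.132) p.422, (3.154)–(3.155) p.427, Thm 3.15 p.432; Balaban1984PropagatorsII, (2.46) p.231, (2.149) p.249] -/
theorem pRowOnΛ_of_ineq3132_nu (O : CfgY 𝔸 x.toKIdx → (IBondY x.toKIdx → 𝔸) →ₗ[ℂ] (IBondY x.toKIdx → 𝔸)) (dd dd' : ℕ) {C δ₁ : ℝ} (hC : 0 ≤ C)
    (hδ₁ : 0 ≤ δ₁) (U : (bg9Y 𝔸 G x).Cfg) (h : B9.Ineq3132 dd (siteKernelOfOpNu x.toKIdx (bg9Y 𝔸 G x) (fun U => U) (nuY dd' x.toKIdx) O) C δ₁ U)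
    {u v : IBondY x.toKIdx} (hu : inΛY x u) (hv : inΛY x v) :
    (⨆ E : BallY 𝔸, ‖(((((((ℓ + 1 : ℕ) : ℝ)) ^ x.k)⁻¹ ^ (d + 1) : ℝ) : ℂ) • O U) (deltaY v (E : 𝔸)) u‖) ≤
      C * Real.exp (-(δ₁ * unitDistY x u v)) := by
  have h1 := h u v
  rw [siteKernelOfOpNu_ker, abs_of_nonneg (mul_nonneg (mul_nonneg (nuY_pos dd' x.toKIdx u).le (nuY_pos dd' x.toKIdx v).le)
    (siteKernelOfOp_ker_nonneg x.toKIdx (bg9Y 𝔸 G x) (fun U => U) O id id U u v)), nuY_mul_nuY_of_inΛY x dd' hu hv,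
    len_eq_one_of_inΛY x hu, len_eq_one_of_inΛY x hv, Real.one_rpow, Real.one_rpow, mul_one, mul_one] at h1
  have h2 : ((((ℓ + 1 : ℕ) : ℝ)) ^ x.k)⁻¹ ^ (d + 1) * (⨆ E : BallY 𝔸, ‖O U (deltaY v (E : 𝔸)) u‖) ≤
      C * Real.exp (-(δ₁ * (geo9Y x).dist u v)) := h1
  rw [iSup_norm_real_smul_deltaY (pow_nonneg (inv_nonneg.2 (pow_nonneg (by positivity) _)) _)]
  exact h2.trans (mul_le_mul_of_nonneg_left (Real.exp_le_exp.2 (neg_le_neg (mul_le_mul_of_nonneg_left (unitDistY_le_dist (x := x) u v) hδ₁))) hC)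

/-- ★ the same with the pointwise kernel reading inside the norm (`E` with `‖E‖ ≤ 1`): `‖((λ_x : ℂ)•O(U))(δ_v ⊗ E)(u)‖ ≤ C·e^{−δ₁|y_u − y_v|}`.
[cite: Balaban1985BackgroundPropagators, (3.132) p.422, bookkeeping] -/
theorem norm_smul_apply_deltaY_le_of_ineq3132_nu (O : CfgY 𝔸 x.toKIdx → (IBondY x.toKIdx → 𝔸) →ₗ[ℂ] (IBondY x.toKIdx → 𝔸)) (dd dd' : ℕ)
    {C δ₁ : ℝ} (hC : 0 ≤ C) (hδ₁ : 0 ≤ δ₁) (U : (bg9Y 𝔸 G x).Cfg)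
    (h : B9.Ineq3132 dd (siteKernelOfOpNu x.toKIdx (bg9Y 𝔸 G x) (fun U => U) (nuY dd' x.toKIdx) O) C δ₁ U)
    (hbdd : ∀ v u, BddAbove (Set.range fun E : BallY 𝔸 =>
      ‖(((((((ℓ + 1 : ℕ) : ℝ)) ^ x.k)⁻¹ ^ (d + 1) : ℝ) : ℂ) • O U) (deltaY v (E : 𝔸)) u‖))
    {u v : IBondY x.toKIdx} (hu : inΛY x u) (hv : inΛY x v) (E : BallY 𝔸) :
    ‖(((((((ℓ + 1 : ℕ) : ℝ)) ^ x.k)⁻¹ ^ (d + 1) : ℝ) : ℂ) • O U) (deltaY v (E : 𝔸)) u‖ ≤ C * Real.exp (-(δ₁ * unitDistY x u v)) :=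
  (le_ciSup (hbdd v u) E).trans (pRowOnΛ_of_ineq3132_nu x O dd dd' hC hδ₁ U h hu hv)

end One

/-! ## §4  The family form: `B9.Stmt3132Printed` for the `ν`-readings ⟹ the door's `P`-rows on Λ-bonds, thresholds and regularity carried verbatim -/

section Family

variable {G : Subgroup 𝔸ˣ}

/-- ★★ **THE FAMILY FORM**: print's (3.132) statement for the `ν`-weighted readings of two letters `O₀, O` over the whole Stage-3′ family (N06's row 26 shape:
`B9.Stmt3132Printed dd c35 geo9Y bg9Y (ν-reading O₀) (ν-reading O)`) gives the door's print-unit `P`-row for `O` on Λ-bonds with ONE pair of constants `(C, δ₁)`,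
under print's thresholds `M₄ ≤ M`, `Mα₀ ≤ a₀` and regularity (3.35)–(3.36) — carried verbatim.
[cite: Balaban1985BackgroundPropagators, (3.132) p.422, Thm 3.12 p.423 (prefix), (3.35)–(3.36) p.396; Balaban1984PropagatorsII, (2.149) p.249] -/
theorem pRowOnΛ_family_of_stmt3132Printed_nu (dd dd' : ℕ) {c35 : ℝ}
    (O₀ O : ∀ x : MemberY d ℓ hd hL b₀ b₁ Mstar, CfgY 𝔸 x.toKIdx → (IBondY x.toKIdx → 𝔸) →ₗ[ℂ] (IBondY x.toKIdx → 𝔸))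
    (h : B9.Stmt3132Printed dd c35 (geo9Y (d := d) (ℓ := ℓ) (hd := hd) (hL := hL) (b₀ := b₀) (b₁ := b₁) (Mstar := Mstar)) (bg9Y 𝔸 G)
      (fun x => siteKernelOfOpNu x.toKIdx (bg9Y 𝔸 G x) (fun U => U) (nuY dd' x.toKIdx) (O₀ x))
      (fun x => siteKernelOfOpNu x.toKIdx (bg9Y 𝔸 G x) (fun U => U) (nuY dd' x.toKIdx) (O x))) :
    ∃ M₄ δ₁ a₀ C : ℝ, 0 < M₄ ∧ 0 < δ₁ ∧ 0 < a₀ ∧ 0 < C ∧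
      ∀ x : MemberY d ℓ hd hL b₀ b₁ Mstar, M₄ ≤ (geo9Y x).M → ∀ α₀ : ℝ, 0 < α₀ → (geo9Y x).M * α₀ ≤ a₀ →
        ∀ U : (bg9Y 𝔸 G x).Cfg, (bg9Y 𝔸 G x).Reg335 c35 α₀ U → (bg9Y 𝔸 G x).Reg336 c35 α₀ U →
          ∀ u v : IBondY x.toKIdx, inΛY x u → inΛY x v →
            (⨆ E : BallY 𝔸, ‖(((((((ℓ + 1 : ℕ) : ℝ)) ^ x.k)⁻¹ ^ (d + 1) : ℝ) : ℂ) • O x U) (deltaY v (E : 𝔸)) u‖) ≤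
              C * Real.exp (-(δ₁ * unitDistY x u v)) := by
  obtain ⟨M₄, δ₁, a₀, C, hM, hδ, ha, hC, H⟩ := h
  refine ⟨M₄, δ₁, a₀, C, hM, hδ, ha, hC, fun x hMx α₀ hα hMa U h35 h36 u v hu hv => ?_⟩
  exact pRowOnΛ_of_ineq3132_nu x (O x) dd dd' hC.le hδ.le U (H x hMx α₀ hα hMa U h35 h36).2 hu hv

end Family

/-! ## §5  AT THE `ν`-INSTANCE OF RECORD `opsYNuOfRecordV4E`: the door's (R2′a)|_Λ is N06's row 26 BY NAME -/

section Record

open scoped Matrix.Norms.L2Operator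
open B7Prop2SpecialUnitary (specialUnitaryUnits)

variable {N : ℕ} (θ : Stage3Params) (Mstar' : ℕ) (𝔯 : ResY N θ Mstar') (𝔢 : SectEY N θ Mstar') (𝔴 : RWEY N θ Mstar') (𝔈 : ExpsY N θ Mstar')

/-- ★★★ **AT THE RECORD, PER BACKGROUND**: N06's repaired (3.132) for the row-26 field `(opsYNuOfRecordV4E N θ M⋆ 𝔯 𝔢 𝔴 𝔈 x).QG1Qinv` at `U` with constants
`(C, δ₁)` gives the print-unit door's (R2′a) on Λ-bonds for `(lettersYOfRecordV4 N θ M⋆ 𝔯 x).QG1Qinv U` with `B_P := C`, `δ := δ₁` — the door's hypothesis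
shape character for character (token `((((θ.ℓ₆+1 : ℕ) : ℝ) ^ x.k)⁻¹) ^ (θ.d₆+1)` = def-Y's `etaDY x`; `(lettersYOfRecordV4 … 𝔯 x).QG1Qinv` is the
`QG1QinvY` letter n06-i reads, def-Y's `covLettersY_v4_QG1Qinv`; at `𝔯 := resYOfC2 N θ M⋆ 𝔠` it is p676397 §3's row).
[cite: Balaban1985BackgroundPropagators, (3.132) p.422, (3.155) p.427; Balaban1984PropagatorsII, (2.149) p.249; Balaban1985UV3, (24) p.262] -/
theorem pRowOnΛ_opsYNuOfRecordV4E_of_ineq3132 (x : MemberY θ.d₆ θ.ℓ₆ θ.hd' θ.hL' θ.b₀ θ.b₁ Mstar') (dd : ℕ) {C δ₁ : ℝ} (hC : 0 ≤ C) (hδ₁ : 0 ≤ δ₁)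
    (U : (bg9Y (Matrix (Fin N) (Fin N) ℂ) (specialUnitaryUnits (Fin N)) x).Cfg)
    (h : B9.Ineq3132 dd ((opsYNuOfRecordV4E N θ Mstar' 𝔯 𝔢 𝔴 𝔈 x).QG1Qinv) C δ₁ U)
    {u v : IBondY x.toKIdx} (hu : inΛY x u) (hv : inΛY x v) :
    (⨆ E : BallY (Matrix (Fin N) (Fin N) ℂ),
        ‖(((((((θ.ℓ₆ + 1 : ℕ) : ℝ)) ^ x.k)⁻¹ ^ (θ.d₆ + 1) : ℝ) : ℂ) • (lettersYOfRecordV4 N θ Mstar' 𝔯 x).QG1Qinv U)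
          (deltaY v (E : Matrix (Fin N) (Fin N) ℂ)) u‖) ≤ C * Real.exp (-(δ₁ * unitDistY x u v)) := by
  rw [opsYNuOfRecordV4E_QG1Qinv] at h
  exact pRowOnΛ_of_ineq3132_nu x _ dd (θ.d₆ + 1) hC hδ₁ U h hu hv

/-- ★★★ **AT THE RECORD, FAMILY FORM — THE DOOR's (R2′a)|_Λ IS N06's ROW 26 BY NAME**: the conclusion TYPE of n06-i's `s3132Nu_opsYNuOfRecordV4E`
(`B9.Stmt3132Printed (θ.d₆+1) c35 geo9Y bg9Y (…QGQinv) (…QG1Qinv)`) gives, with ONE pair `(C, δ₁)` for the whole family and under print's thresholds ∕ regularity,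
the print-unit `P`-row on Λ-bonds for `(lettersYOfRecordV4 N θ M⋆ 𝔯 x).QG1Qinv U` at every member.
[cite: Balaban1985BackgroundPropagators, (3.132) p.422, Thm 3.12 p.423, (3.35)–(3.36) p.396; Balaban1984PropagatorsII, (2.149) p.249; Balaban1985UV3, (24) p.262] -/
theorem pRowOnΛ_family_opsYNuOfRecordV4E {c35 : ℝ}
    (h : B9.Stmt3132Printed (θ.d₆ + 1) c35
      (geo9Y (d := θ.d₆) (ℓ := θ.ℓ₆) (hd := θ.hd') (hL := θ.hL') (b₀ := θ.b₀) (b₁ := θ.b₁) (Mstar := Mstar'))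
      (bg9Y (Matrix (Fin N) (Fin N) ℂ) (specialUnitaryUnits (Fin N)))
      (fun x => (opsYNuOfRecordV4E N θ Mstar' 𝔯 𝔢 𝔴 𝔈 x).QGQinv) (fun x => (opsYNuOfRecordV4E N θ Mstar' 𝔯 𝔢 𝔴 𝔈 x).QG1Qinv)) :
    ∃ M₄ δ₁ a₀ C : ℝ, 0 < M₄ ∧ 0 < δ₁ ∧ 0 < a₀ ∧ 0 < C ∧
      ∀ x : MemberY θ.d₆ θ.ℓ₆ θ.hd' θ.hL' θ.b₀ θ.b₁ Mstar', M₄ ≤ (geo9Y x).M → ∀ α₀ : ℝ, 0 < α₀ → (geo9Y x).M * α₀ ≤ a₀ →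
        ∀ U : (bg9Y (Matrix (Fin N) (Fin N) ℂ) (specialUnitaryUnits (Fin N)) x).Cfg,
          (bg9Y (Matrix (Fin N) (Fin N) ℂ) (specialUnitaryUnits (Fin N)) x).Reg335 c35 α₀ U →
          (bg9Y (Matrix (Fin N) (Fin N) ℂ) (specialUnitaryUnits (Fin N)) x).Reg336 c35 α₀ U →
          ∀ u v : IBondY x.toKIdx, inΛY x u → inΛY x v →
            (⨆ E : BallY (Matrix (Fin N) (Fin N) ℂ),
                ‖(((((((θ.ℓ₆ + 1 : ℕ) : ℝ)) ^ x.k)⁻¹ ^ (θ.d₆ + 1) : ℝ) : ℂ) • (lettersYOfRecordV4 N θ Mstar' 𝔯 x).QG1Qinv U)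
                  (deltaY v (E : Matrix (Fin N) (Fin N) ℂ)) u‖) ≤ C * Real.exp (-(δ₁ * unitDistY x u v)) := by
  obtain ⟨M₄, δ₁, a₀, C, hM, hδ, ha, hC, H⟩ := h
  refine ⟨M₄, δ₁, a₀, C, hM, hδ, ha, hC, fun x hMx α₀ hα hMa U h35 h36 u v hu hv => ?_⟩
  exact pRowOnΛ_opsYNuOfRecordV4E_of_ineq3132 θ Mstar' 𝔯 𝔢 𝔴 𝔈 x (θ.d₆ + 1) hC.le hδ.le U (H x hMx α₀ hα hMa U h35 h36).2 hu hv

end Record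

/-! ## §6 (v1.1) TOP-LEVEL ∕ STAR PAIRS: the dictionary holds on ANY two top-level bonds (`lvl = k`), in particular on node00-def-Y's STAR variables
`inΛstY` (at least one end block good — [4] (2.3) p. 224) — the (R2′) row of the (3.24) door AT THE STAR LETTERS (dag-n08-b INTENT-22∕23) -/

section TopStar

variable {G : Subgroup 𝔸ˣ} (x : MemberY d ℓ hd hL b₀ b₁ Mstar)

/-- ★ on ANY top-level bond the scale length is `Lᵏη = 1` (§1 `len_eq_one_of_inΛY` used only `lvl u = k`).
[cite: Balaban1985BackgroundPropagators, (3.41) p.397; Balaban1984PropagatorsII, (2.1) p.224, bookkeeping] -/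
theorem len_eq_one_of_lvl_eq {u : IBondY x.toKIdx} (hu : lvl x.hN x.D x.hk u = x.k) : (geo9K x.toKIdx).len u = 1 := by
  rw [geo9K_len_kGeo, len_eq, hu, abs_of_pos (cf_pos x), x.hcfk]
  exact div_self (pow_ne_zero _ (by positivity))

/-- ★ [4]'s `Λ_u² = ((Lᵏ)⁻¹)^{d+1}` on ANY top-level bond. [cite: Balaban1984PropagatorsII, (2.142) p.248, (2.81) p.237, (2.1) p.224, bookkeeping] -/
theorem wt_eq_inv_pow_of_lvl_eq {u : IBondY x.toKIdx} (hu : lvl x.hN x.D x.hk u = x.k) :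
    wt x.hN x.D x.hk x.cf u = ((((ℓ + 1 : ℕ) : ℝ)) ^ x.k)⁻¹ ^ (d + 1) := by
  unfold wt
  rw [hu, x.hcfk, div_self (pow_ne_zero _ (by positivity)), one_pow, one_mul, ← pow_mul, inv_pow, ← pow_mul, mul_comm]

/-- `Λ_u·Λ_v = ((Lᵏ)⁻¹)^{d+1}` for two top-level bonds. [cite: Balaban1984PropagatorsII, (2.81) p.237, (2.142) p.248, bookkeeping] -/
theorem lamY_mul_lamY_of_lvl_eq {u v : IBondY x.toKIdx} (hu : lvl x.hN x.D x.hk u = x.k) (hv : lvl x.hN x.D x.hk v = x.k) :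
    lamY x.toKIdx u * lamY x.toKIdx v = ((((ℓ + 1 : ℕ) : ℝ)) ^ x.k)⁻¹ ^ (d + 1) := by
  unfold lamY lam
  rw [wt_eq_inv_pow_of_lvl_eq x hu, wt_eq_inv_pow_of_lvl_eq x hv]
  exact Real.mul_self_sqrt (pow_nonneg (inv_nonneg.2 (pow_nonneg (by positivity) _)) _)

/-- ★ **THE `ν`-WEIGHTS OF TWO TOP-LEVEL BONDS MULTIPLY TO PRINT's UNIT FACTOR** `ν(u)ν(v) = ((Lᵏ)⁻¹)^{d+1} = η^{d+1}`, any dimension exponent.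
[cite: Balaban1985BackgroundPropagators, (3.132) p.422; Balaban1984PropagatorsII, (2.149) p.249, (2.1) p.224] -/
theorem nuY_mul_nuY_of_lvl_eq (dd : ℕ) {u v : IBondY x.toKIdx} (hu : lvl x.hN x.D x.hk u = x.k) (hv : lvl x.hN x.D x.hk v = x.k) :
    nuY dd x.toKIdx u * nuY dd x.toKIdx v = ((((ℓ + 1 : ℕ) : ℝ)) ^ x.k)⁻¹ ^ (d + 1) := by
  unfold nuY
  rw [len_eq_one_of_lvl_eq x hu, len_eq_one_of_lvl_eq x hv, Real.one_rpow, one_mul, one_mul]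
  exact lamY_mul_lamY_of_lvl_eq x hu hv

/-- ★★★ **THE `P`-ROW OF THE PRINT-UNIT DOOR ON ANY TWO TOP-LEVEL BONDS FROM N06's REPAIRED (3.132)** (§3 `pRowOnΛ_of_ineq3132_nu` verbatim with `inΛY`
replaced by `lvl = k`): for ANY letter `O(U)`, if the `ν`-weighted reading satisfies (3.132) at `U` with `(C, δ₁)`, then for top-level bonds `u, v`
`⨆_{‖E‖≤1} ‖((λ_x : ℂ)•O(U))(δ_v ⊗ E)(u)‖ ≤ C·e^{−δ₁|y_u − y_v|}`, `λ_x = ((Lᵏ)⁻¹)^{d+1}`.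
[cite: Balaban1985BackgroundPropagators, (3.132) p.422, (3.154)–(3.155) p.427, Thm 3.15 p.432; Balaban1984PropagatorsII, (2.46) p.231, (2.149) p.249] -/
theorem pRowTop_of_ineq3132_nu (O : CfgY 𝔸 x.toKIdx → (IBondY x.toKIdx → 𝔸) →ₗ[ℂ] (IBondY x.toKIdx → 𝔸)) (dd dd' : ℕ) {C δ₁ : ℝ} (hC : 0 ≤ C)
    (hδ₁ : 0 ≤ δ₁) (U : (bg9Y 𝔸 G x).Cfg) (h : B9.Ineq3132 dd (siteKernelOfOpNu x.toKIdx (bg9Y 𝔸 G x) (fun U => U) (nuY dd' x.toKIdx) O) C δ₁ U)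
    {u v : IBondY x.toKIdx} (hu : lvl x.hN x.D x.hk u = x.k) (hv : lvl x.hN x.D x.hk v = x.k) :
    (⨆ E : BallY 𝔸, ‖(((((((ℓ + 1 : ℕ) : ℝ)) ^ x.k)⁻¹ ^ (d + 1) : ℝ) : ℂ) • O U) (deltaY v (E : 𝔸)) u‖) ≤
      C * Real.exp (-(δ₁ * unitDistY x u v)) := by
  have h1 := h u v
  rw [siteKernelOfOpNu_ker, abs_of_nonneg (mul_nonneg (mul_nonneg (nuY_pos dd' x.toKIdx u).le (nuY_pos dd' x.toKIdx v).le)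
    (siteKernelOfOp_ker_nonneg x.toKIdx (bg9Y 𝔸 G x) (fun U => U) O id id U u v)), nuY_mul_nuY_of_lvl_eq x dd' hu hv,
    len_eq_one_of_lvl_eq x hu, len_eq_one_of_lvl_eq x hv, Real.one_rpow, Real.one_rpow, mul_one, mul_one] at h1
  have h2 : ((((ℓ + 1 : ℕ) : ℝ)) ^ x.k)⁻¹ ^ (d + 1) * (⨆ E : BallY 𝔸, ‖O U (deltaY v (E : 𝔸)) u‖) ≤
      C * Real.exp (-(δ₁ * (geo9Y x).dist u v)) := h1
  rw [iSup_norm_real_smul_deltaY (pow_nonneg (inv_nonneg.2 (pow_nonneg (by positivity) _)) _)]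
  exact h2.trans (mul_le_mul_of_nonneg_left (Real.exp_le_exp.2 (neg_le_neg (mul_le_mul_of_nonneg_left (unitDistY_le_dist (x := x) u v) hδ₁))) hC)

/-- ★★★ **THE `P`-ROW ON node00-def-Y's STAR PAIRS** (`inΛstY` = top level with at least one end block good — the variables of the (3.24) door at the
star letters): `pRowTop_of_ineq3132_nu` at `hu.1`, `hv.1`. [cite: Balaban1985BackgroundPropagators, (3.132) p.422, (3.155) p.427; Balaban1984PropagatorsII, (2.3) p.224, (2.149) p.249] -/
theorem pRowOnΛst_of_ineq3132_nu (O : CfgY 𝔸 x.toKIdx → (IBondY x.toKIdx → 𝔸) →ₗ[ℂ] (IBondY x.toKIdx → 𝔸)) (dd dd' : ℕ) {C δ₁ : ℝ} (hC : 0 ≤ C)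
    (hδ₁ : 0 ≤ δ₁) (U : (bg9Y 𝔸 G x).Cfg) (h : B9.Ineq3132 dd (siteKernelOfOpNu x.toKIdx (bg9Y 𝔸 G x) (fun U => U) (nuY dd' x.toKIdx) O) C δ₁ U)
    {u v : IBondY x.toKIdx} (hu : inΛstY x u) (hv : inΛstY x v) :
    (⨆ E : BallY 𝔸, ‖(((((((ℓ + 1 : ℕ) : ℝ)) ^ x.k)⁻¹ ^ (d + 1) : ℝ) : ℂ) • O U) (deltaY v (E : 𝔸)) u‖) ≤
      C * Real.exp (-(δ₁ * unitDistY x u v)) :=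
  pRowTop_of_ineq3132_nu x O dd dd' hC hδ₁ U h hu.1 hv.1

/-- ★ the pointwise form on star pairs (`E` with `‖E‖ ≤ 1`, under the boundedness of the sup-reading). [cite: Balaban1985BackgroundPropagators, (3.132) p.422, bookkeeping] -/
theorem norm_smul_apply_deltaY_le_of_ineq3132_nu_st (O : CfgY 𝔸 x.toKIdx → (IBondY x.toKIdx → 𝔸) →ₗ[ℂ] (IBondY x.toKIdx → 𝔸)) (dd dd' : ℕ)
    {C δ₁ : ℝ} (hC : 0 ≤ C) (hδ₁ : 0 ≤ δ₁) (U : (bg9Y 𝔸 G x).Cfg)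
    (h : B9.Ineq3132 dd (siteKernelOfOpNu x.toKIdx (bg9Y 𝔸 G x) (fun U => U) (nuY dd' x.toKIdx) O) C δ₁ U)
    (hbdd : ∀ v u, BddAbove (Set.range fun E : BallY 𝔸 =>
      ‖(((((((ℓ + 1 : ℕ) : ℝ)) ^ x.k)⁻¹ ^ (d + 1) : ℝ) : ℂ) • O U) (deltaY v (E : 𝔸)) u‖))
    {u v : IBondY x.toKIdx} (hu : inΛstY x u) (hv : inΛstY x v) (E : BallY 𝔸) :
    ‖(((((((ℓ + 1 : ℕ) : ℝ)) ^ x.k)⁻¹ ^ (d + 1) : ℝ) : ℂ) • O U) (deltaY v (E : 𝔸)) u‖ ≤ C * Real.exp (-(δ₁ * unitDistY x u v)) :=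
  (le_ciSup (hbdd v u) E).trans (pRowOnΛst_of_ineq3132_nu x O dd dd' hC hδ₁ U h hu hv)

end TopStar

section RecordTopStar

open scoped Matrix.Norms.L2Operator
open B7Prop2SpecialUnitary (specialUnitaryUnits)

variable {N : ℕ} (θ : Stage3Params) (Mstar' : ℕ) (𝔯 : ResY N θ Mstar') (𝔢 : SectEY N θ Mstar') (𝔴 : RWEY N θ Mstar') (𝔈 : ExpsY N θ Mstar')

/-- ★★★ **AT THE RECORD, PER BACKGROUND, ANY TWO TOP-LEVEL BONDS**: N06's repaired (3.132) for `(opsYNuOfRecordV4E N θ M⋆ 𝔯 𝔢 𝔴 𝔈 x).QG1Qinv` at `U`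
gives the print-unit door's (R2′a) for `(lettersYOfRecordV4 N θ M⋆ 𝔯 x).QG1Qinv U` on top-level pairs (§5's token shape, `inΛY` ↦ `lvl = k`).
[cite: Balaban1985BackgroundPropagators, (3.132) p.422, (3.155) p.427; Balaban1984PropagatorsII, (2.149) p.249; Balaban1985UV3, (24) p.262] -/
theorem pRowTop_opsYNuOfRecordV4E_of_ineq3132 (x : MemberY θ.d₆ θ.ℓ₆ θ.hd' θ.hL' θ.b₀ θ.b₁ Mstar') (dd : ℕ) {C δ₁ : ℝ} (hC : 0 ≤ C) (hδ₁ : 0 ≤ δ₁)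
    (U : (bg9Y (Matrix (Fin N) (Fin N) ℂ) (specialUnitaryUnits (Fin N)) x).Cfg)
    (h : B9.Ineq3132 dd ((opsYNuOfRecordV4E N θ Mstar' 𝔯 𝔢 𝔴 𝔈 x).QG1Qinv) C δ₁ U)
    {u v : IBondY x.toKIdx} (hu : lvl x.hN x.D x.hk u = x.k) (hv : lvl x.hN x.D x.hk v = x.k) :
    (⨆ E : BallY (Matrix (Fin N) (Fin N) ℂ),
        ‖(((((((θ.ℓ₆ + 1 : ℕ) : ℝ)) ^ x.k)⁻¹ ^ (θ.d₆ + 1) : ℝ) : ℂ) • (lettersYOfRecordV4 N θ Mstar' 𝔯 x).QG1Qinv U)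
          (deltaY v (E : Matrix (Fin N) (Fin N) ℂ)) u‖) ≤ C * Real.exp (-(δ₁ * unitDistY x u v)) := by
  rw [opsYNuOfRecordV4E_QG1Qinv] at h
  exact pRowTop_of_ineq3132_nu x _ dd (θ.d₆ + 1) hC hδ₁ U h hu hv

/-- ★★★ **AT THE RECORD, PER BACKGROUND, STAR PAIRS** (`inΛstY`): the (R2′) row of the (3.24) door at the star letters, from N06's repaired (3.132) for the
row-26 field at `U`. [cite: Balaban1985BackgroundPropagators, (3.132) p.422, (3.155) p.427; Balaban1984PropagatorsII, (2.3) p.224, (2.149) p.249; Balaban1985UV3, (24) p.262] -/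
theorem pRowOnΛst_opsYNuOfRecordV4E_of_ineq3132 (x : MemberY θ.d₆ θ.ℓ₆ θ.hd' θ.hL' θ.b₀ θ.b₁ Mstar') (dd : ℕ) {C δ₁ : ℝ} (hC : 0 ≤ C) (hδ₁ : 0 ≤ δ₁)
    (U : (bg9Y (Matrix (Fin N) (Fin N) ℂ) (specialUnitaryUnits (Fin N)) x).Cfg)
    (h : B9.Ineq3132 dd ((opsYNuOfRecordV4E N θ Mstar' 𝔯 𝔢 𝔴 𝔈 x).QG1Qinv) C δ₁ U)
    {u v : IBondY x.toKIdx} (hu : inΛstY x u) (hv : inΛstY x v) :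
    (⨆ E : BallY (Matrix (Fin N) (Fin N) ℂ),
        ‖(((((((θ.ℓ₆ + 1 : ℕ) : ℝ)) ^ x.k)⁻¹ ^ (θ.d₆ + 1) : ℝ) : ℂ) • (lettersYOfRecordV4 N θ Mstar' 𝔯 x).QG1Qinv U)
          (deltaY v (E : Matrix (Fin N) (Fin N) ℂ)) u‖) ≤ C * Real.exp (-(δ₁ * unitDistY x u v)) :=
  pRowTop_opsYNuOfRecordV4E_of_ineq3132 θ Mstar' 𝔯 𝔢 𝔴 𝔈 x dd hC hδ₁ U h hu.1 hv.1

/-- ★★ **AT THE RECORD, FAMILY FORM ON STAR PAIRS**: the conclusion TYPE of n06-i's `s3132Nu_opsYNuOfRecordV4E` gives, with ONE pair `(C, δ₁)` and under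
print's thresholds ∕ regularity, the print-unit `P`-row on `inΛstY` pairs at every member (§5 `pRowOnΛ_family_opsYNuOfRecordV4E` with `inΛY` ↦ `inΛstY`).
[cite: Balaban1985BackgroundPropagators, (3.132) p.422, Thm 3.12 p.423, (3.35)–(3.36) p.396; Balaban1984PropagatorsII, (2.3) p.224, (2.149) p.249; Balaban1985UV3, (24) p.262] -/
theorem pRowOnΛst_family_opsYNuOfRecordV4E {c35 : ℝ}
    (h : B9.Stmt3132Printed (θ.d₆ + 1) c35
      (geo9Y (d := θ.d₆) (ℓ := θ.ℓ₆) (hd := θ.hd') (hL := θ.hL') (b₀ := θ.b₀) (b₁ := θ.b₁) (Mstar := Mstar'))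
      (bg9Y (Matrix (Fin N) (Fin N) ℂ) (specialUnitaryUnits (Fin N)))
      (fun x => (opsYNuOfRecordV4E N θ Mstar' 𝔯 𝔢 𝔴 𝔈 x).QGQinv) (fun x => (opsYNuOfRecordV4E N θ Mstar' 𝔯 𝔢 𝔴 𝔈 x).QG1Qinv)) :
    ∃ M₄ δ₁ a₀ C : ℝ, 0 < M₄ ∧ 0 < δ₁ ∧ 0 < a₀ ∧ 0 < C ∧
      ∀ x : MemberY θ.d₆ θ.ℓ₆ θ.hd' θ.hL' θ.b₀ θ.b₁ Mstar', M₄ ≤ (geo9Y x).M → ∀ α₀ : ℝ, 0 < α₀ → (geo9Y x).M * α₀ ≤ a₀ →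
        ∀ U : (bg9Y (Matrix (Fin N) (Fin N) ℂ) (specialUnitaryUnits (Fin N)) x).Cfg,
          (bg9Y (Matrix (Fin N) (Fin N) ℂ) (specialUnitaryUnits (Fin N)) x).Reg335 c35 α₀ U →
          (bg9Y (Matrix (Fin N) (Fin N) ℂ) (specialUnitaryUnits (Fin N)) x).Reg336 c35 α₀ U →
          ∀ u v : IBondY x.toKIdx, inΛstY x u → inΛstY x v →
            (⨆ E : BallY (Matrix (Fin N) (Fin N) ℂ),
                ‖(((((((θ.ℓ₆ + 1 : ℕ) : ℝ)) ^ x.k)⁻¹ ^ (θ.d₆ + 1) : ℝ) : ℂ) • (lettersYOfRecordV4 N θ Mstar' 𝔯 x).QG1Qinv U)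
                  (deltaY v (E : Matrix (Fin N) (Fin N) ℂ)) u‖) ≤ C * Real.exp (-(δ₁ * unitDistY x u v)) := by
  obtain ⟨M₄, δ₁, a₀, C, hM, hδ, ha, hC, H⟩ := h
  refine ⟨M₄, δ₁, a₀, C, hM, hδ, ha, hC, fun x hMx α₀ hα hMa U h35 h36 u v hu hv => ?_⟩
  exact pRowOnΛst_opsYNuOfRecordV4E_of_ineq3132 θ Mstar' 𝔯 𝔢 𝔴 𝔈 x (θ.d₆ + 1) hC.le hδ.le U (H x hMx α₀ hα hMa U h35 h36).2 hu hv

end RecordTopStar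

end Literature.MathematicalPhysics.QuantumFieldTheory.Balaban1983to89.B1Eq324BenfattoClassSectEMemberPRowDictionaryAtNode00
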